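import Literature.AnabelianGeometry.AbsoluteAnabelian.FreeProSigmaCompletionBridge
import Literature.AnabelianGeometry.SemiGraphs.ProSigmaPuncturedSurfaceElastic
import Literature.AnabelianGeometry.SemiGraphs.ProSigmaCompletionModels
import HarnessLib

/-!
# Non-vacuity: profinite completions of free / punctured surface groups are free pro-`𝔓𝔯𝔦𝔪𝔢𝔰`, slim, elastic

S. Mochizuki, *Topics in Absolute Anabelian Geometry I: Generalities* (2012) [AbsTopI], Lemma 4.5 (i)
p. 54 ("free pro-`Σ`") and Prop. 2.3 (i) p. 19 ("`Δ` is slim and elastic"); *Semi-graphs of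
Anabelioids* (2006) [SemiAnbd] Example 2.10 p. 31 (pro-`Σ` completions).  PROOF-ONLY file (no
definitions, no named facts): GENUINE INHABITANTS, at `Σ = 𝔓𝔯𝔦𝔪𝔢𝔰` and Mathlib's profinite completion
`F̂ = profiniteCompletion F` (abc-iut-L5's `Literature.IUT.HodgeTheaters.profiniteCompletion`, with
`η = toCompletion F`), of three abc-iut predicates that so far had consumers but no witness at a genuine
object:

* `isFreeProOn_profiniteCompletion_freeGroup` / `isFreePro_profiniteCompletion_freeGroup` — the L4
  universal-property predicate `IsFreeProOn` / `IsFreePro` of [AbsTopI] Lem. 4.5 (i) (abc-iut-L4-t4;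
  vocabulary of FACT-LIST F-0208 `NonProperIffFree`) holds for `F̂_n` on the letters `η (of i)`: by
  abc-iut-L4-t15's bridge `isFreeProOn_of_isProSigmaCompletion_lift` (p424814) applied to the L3/L5 model
  theorem `IsProSigmaCompletion.isProSigmaCompletion_toCompletion` (`η : F → F̂` is a pro-`𝔓𝔯𝔦𝔪𝔢𝔰`
  completion for EVERY group `F`);
* `isSlimGroup_profiniteCompletion_freeGroup` — `F̂_n` is slim for `n ≥ 2` (the bridge's corollary fires);
* `freeProlRank_profiniteCompletion_freeGroup_eq` — `δ¹_ℓ(F̂_n) = n` for every prime `ℓ`, and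
  `freeProlRank_of_isOpen_profiniteCompletion_freeGroup` — `δ¹_ℓ(U) = (n − 1)·[F̂_n : U] + 1` for open `U`
  (abc-iut-w5-d206's p424779);
* `isElastic_profiniteCompletion_freeGroup` — `F̂_n` is ELASTIC for `n ≥ 2` ([AbsTopI] Def. 1.1 (ii));
* `slim_and_elastic_profiniteCompletion_puncturedSurfaceGroup` — [AbsTopI] Prop. 2.3 (i) "slim and
  elastic" AT A GENUINE OBJECT: the profinite completion of every hyperbolic punctured surface group
  `Γ_{g,r}`, `r ≥ 1`; e.g. the once-punctured torus `Γ_{1,1}`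
  (`slim_and_elastic_profiniteCompletion_oncePuncturedTorus`).

HONEST FRAMING: classical profinite group theory; consistency evidence for the typed interfaces only
(instantiated ≠ endorsed); nothing here bears on [IUTchIII] Cor. 3.12.
-/

noncomputable section

namespace Literature.AnabelianGeometry.AbsoluteAnabelian

open Literature.AnabelianGeometry.SemiGraphs.SemiGraphOfAnabelioids
open Literature.IUT.HodgeTheaters (profiniteCompletion toCompletion)
open Literature.AlgebraicGeometry.Frobenioids (IsSlimGroup)
open Literature.GroupTheory.CombinatorialGroupTheory (PuncturedSurfaceGroup)

/-- `η : F_n → F̂_n` IS `FreeGroup.lift` of the letter assignment `i ↦ η (of i)`. [folklore] -/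
private theorem lift_toCompletion_of (n : ℕ) :
    FreeGroup.lift (fun i => toCompletion (FreeGroup (Fin n)) (FreeGroup.of i)) =
      toCompletion (FreeGroup (Fin n)) :=
  FreeGroup.ext_hom _ _ fun i => by rw [FreeGroup.lift_apply_of]

/-- **`F̂_n` is free pro-`𝔓𝔯𝔦𝔪𝔢𝔰` on the letters** in the sense of the L4 predicate `IsFreeProOn`
([AbsTopI] Lem. 4.5 (i)): a genuine inhabitant.  Bridge (p424814) + model theorem
(`isProSigmaCompletion_toCompletion`). [cite: MochizukiAbsTopI2012, Lemma 4.5 (i) p.54] -/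
theorem isFreeProOn_profiniteCompletion_freeGroup (n : ℕ) :
    IsFreeProOn (profiniteCompletion (FreeGroup (Fin n))) {p : ℕ | p.Prime}
      (fun i => toCompletion (FreeGroup (Fin n)) (FreeGroup.of i)) := by
  refine isFreeProOn_of_isProSigmaCompletion_lift ?_
  rw [lift_toCompletion_of]
  exact IsProSigmaCompletion.isProSigmaCompletion_toCompletion (FreeGroup (Fin n))

/-- Hence **`IsFreePro F̂_n 𝔓𝔯𝔦𝔪𝔢𝔰`** ("free pro-`Σ` of some finite rank") is inhabited at a genuine
object, for every `n`. [cite: MochizukiAbsTopI2012, Lemma 4.5 (i) p.54] -/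
theorem isFreePro_profiniteCompletion_freeGroup (n : ℕ) :
    IsFreePro (profiniteCompletion (FreeGroup (Fin n))) {p : ℕ | p.Prime} :=
  ⟨n, _, isFreeProOn_profiniteCompletion_freeGroup n⟩

/-- **`F̂_n` is slim for `n ≥ 2`** — the bridge's corollary `IsFreeProOn.isSlimGroup` fires at the
genuine object ([AbsTopI] Prop. 2.3 (i), slim half, affine model at all primes).
[cite: MochizukiAbsTopI2012, Prop 2.3 (i) p.19] -/
theorem isSlimGroup_profiniteCompletion_freeGroup (n : ℕ) (hn : 2 ≤ n) :
    IsSlimGroup (profiniteCompletion (FreeGroup (Fin n))) :=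
  (isFreeProOn_profiniteCompletion_freeGroup n).isSlimGroup hn

/-- **`δ¹_ℓ(F̂_n) = n`** for every prime `ℓ` ([AbsTopI] Thm. 2.6's invariant at the free profinite group;
abc-iut-w5-d206's `freeProlRank_eq_card_of_isProSigmaCompletion_freeGroup`, p424779).
[cite: MochizukiAbsTopI2012, Thm 2.6 p.21] -/
theorem freeProlRank_profiniteCompletion_freeGroup_eq (n ℓ : ℕ) [Fact ℓ.Prime] :
    freeProlRank (profiniteCompletion (FreeGroup (Fin n))) ℓ = (n : ℕ∞) := by
  rw [freeProlRank_eq_card_of_isProSigmaCompletion_freeGroup (α := Fin n)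
    (IsProSigmaCompletion.isProSigmaCompletion_toCompletion (FreeGroup (Fin n))) (Fact.out : ℓ.Prime),
    Fintype.card_fin]

/-- **`δ¹_ℓ(U) = (n − 1)·[F̂_n : U] + 1`** for every open subgroup `U ⊆ F̂_n` (`n ≥ 1`, `ℓ` prime):
Nielsen–Schreier + Schreier's index formula at the genuine object (p424779).
[cite: MochizukiAbsTopI2012, Prop 2.3 (i) p.19] -/
theorem freeProlRank_of_isOpen_profiniteCompletion_freeGroup (n ℓ : ℕ) [Fact ℓ.Prime] (hn : 1 ≤ n)
    (U : Subgroup (profiniteCompletion (FreeGroup (Fin n))))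
    (hU : IsOpen (U : Set (profiniteCompletion (FreeGroup (Fin n))))) :
    freeProlRank U ℓ = (((n - 1) * U.index + 1 : ℕ) : ℕ∞) := by
  have h := freeProlRank_eq_of_isOpen_of_isProSigmaCompletion_freeGroup (α := Fin n)
    (IsProSigmaCompletion.isProSigmaCompletion_toCompletion (FreeGroup (Fin n))) (Fact.out : ℓ.Prime)
    (by rw [Fintype.card_fin]; exact hn) U hU
  rwa [Fintype.card_fin] at h

/-- **`F̂_n` is ELASTIC for `n ≥ 2`** ([AbsTopI] Def. 1.1 (ii) / Prop. 2.3 (i), elastic half, at the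
free profinite group: abc-iut-w5-d206's `isElastic_of_isProSigmaCompletion_freeGroup` over
abc-iut-L4-t15's affine rank criterion, at the genuine object). [cite: MochizukiAbsTopI2012, Prop 2.3 (i) p.19] -/
theorem isElastic_profiniteCompletion_freeGroup (n : ℕ) (hn : 2 ≤ n) :
    IsElastic (profiniteCompletion (FreeGroup (Fin n))) :=
  isElastic_of_isProSigmaCompletion_freeGroup (α := Fin n) (by rw [Fintype.card_fin]; exact hn)
    (IsProSigmaCompletion.isProSigmaCompletion_toCompletion (FreeGroup (Fin n)))
    ⟨2, Nat.prime_two, Nat.prime_two⟩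

/-- **[AbsTopI] Prop. 2.3 (i) "`Δ` is slim and elastic" AT A GENUINE OBJECT**: the profinite
completion of every hyperbolic punctured surface group `Γ_{g,r}` (`r ≥ 1`, `2g − 2 + r > 0`) is slim and
elastic (p424779's `slim_and_elastic_of_isProSigmaCompletion_puncturedSurfaceGroup` at the model theorem).
[cite: MochizukiAbsTopI2012, Prop 2.3 (i) p.19] -/
theorem slim_and_elastic_profiniteCompletion_puncturedSurfaceGroup (g r : ℕ) (hr : 1 ≤ r)
    (h : PuncturedSurfaceGroup.IsHyperbolicType g r) :
    IsSlimGroup (profiniteCompletion (PuncturedSurfaceGroup g r)) ∧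
      IsElastic (profiniteCompletion (PuncturedSurfaceGroup g r)) :=
  slim_and_elastic_of_isProSigmaCompletion_puncturedSurfaceGroup hr h
    (IsProSigmaCompletion.isProSigmaCompletion_toCompletion (PuncturedSurfaceGroup g r))
    ⟨2, Nat.prime_two, Nat.prime_two⟩

/-- The once-punctured torus: `Γ̂_{1,1}` is slim and elastic (type `(1,1)`: `2 < 2·1 + 1`).
[cite: MochizukiAbsTopI2012, Prop 2.3 (i) p.19] -/
theorem slim_and_elastic_profiniteCompletion_oncePuncturedTorus :
    IsSlimGroup (profiniteCompletion (PuncturedSurfaceGroup 1 1)) ∧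
      IsElastic (profiniteCompletion (PuncturedSurfaceGroup 1 1)) :=
  slim_and_elastic_profiniteCompletion_puncturedSurfaceGroup 1 1 le_rfl
    (by unfold PuncturedSurfaceGroup.IsHyperbolicType; omega)

/-- Packaged existence: SOME profinite group is free pro-`𝔓𝔯𝔦𝔪𝔢𝔰` of rank `2` in the L4 sense, slim
and elastic — the hypotheses "`Δ` free pro-`Σ`, slim, elastic" of [AbsTopI] §2/§4 are jointly
satisfiable as typed. [cite: MochizukiAbsTopI2012, Prop 2.3 (i) p.19] -/
theorem exists_isFreeProOn_slim_elastic :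
    ∃ (P : Type) (_ : Group P) (_ : TopologicalSpace P) (_ : IsTopologicalGroup P)
      (gens : Fin 2 → P), IsFreeProOn P {p : ℕ | p.Prime} gens ∧ IsSlimGroup P ∧ IsElastic P :=
  ⟨profiniteCompletion (FreeGroup (Fin 2)), inferInstance, inferInstance, inferInstance, _,
    isFreeProOn_profiniteCompletion_freeGroup 2, isSlimGroup_profiniteCompletion_freeGroup 2 le_rfl,
    isElastic_profiniteCompletion_freeGroup 2 le_rfl⟩

end Literature.AnabelianGeometry.AbsoluteAnabelian

end
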